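import Summits.BirchSwinnertonDyer.BirchSwinnertonDyer.Theorems.ByReductionTypeAtTwoSupersingularFlatKummerInjection
import Summits.BirchSwinnertonDyer.BirchSwinnertonDyer.Theorems.ByReductionTypeAtTwoSupersingularFlatKummerConjugation
import Summits.BirchSwinnertonDyer.BirchSwinnertonDyer.Theorems.AlignedTransportAtTwoMainConjectureOfRankZeroBSDAtTwoFineRoadLocalArch
import Literature.Algebra.Module.PadicPairingFamilies
import Literature.Algebra.Module.PadicFunctionalSeparation
import Literature.NumberTheory.EllipticCurves.Sprung2012.FineSelmerLeSharpFlatSelmerProofs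
import Literature.NumberTheory.EllipticCurves.KatoFineSelmerDual
import Literature.NumberTheory.EllipticCurves.NeronOggShafarevichLocal
import Literature.NumberTheory.EllipticCurves.SubgroupSelmerCocycleCriteriaProofs
import Mathlib.Algebra.Module.CharacterModule
import HarnessLib

/-!
# Route `ByReductionTypeAtTwo` (rung K4), crux `SupersingularRankZeroAtTwo` (item stmt-BirchSwinnertonDyer-19097), line
# `odd_blind_package` v2.18, stub `stub_flatPackage`, conjunct (8), clause F1♭ `Exact toX δ` — the half «`ker δ ⊆ range toX`» (T-δ):
# **every character of `Sel♭(E/ℚ_∞)` vanishing on `Sel₀` is the Kummer pairing with a functional `w ∈ H¹_Iw(ℚ_v, T_pE)`**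
# (cell `bsd-2adic`, seat `bsd-2adic-tower-1` GEN 68, hand hF1♭-ORTH FILE 2; `--supports 19097`, helper)

HONEST FRAMING (D-0054): THEOREMS ONLY — no definition, no named fact, no instance, no `sorry`.  Helper toward conjunct (8);
closes NO stub; 19097 stays OPEN on its 5 registered stubs; nothing booked; BSD₂ is proved for no supersingular curve and BSD for
no curve by any of this; typed ≠ proved.  Generic prime `p`; over `ℚ` (one place above `p`).

## What and why

With `toX : Λ →ₗ X♭ = D.X` the contract map of `SSFlatPackage.exists_flatToXLinearMap_of_mul_eq_one` (p831519; (V̄): `D.toDual (toX (Col♭ w)) s =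
w(p^kQ)/p^k` on every Kummer datum `(φ, Q, k)` of `s ∈ Sel♭` at the chosen place) and `δ : X♭ → X₀ = Y.X` a transpose of `Sel₀ ≤ Sel♭`
(`Y.toDual (δ x) s = D.toDual x s|`, e.g. `Sprung2012.SharpFlatSelmerDualData.exists_linearMap_toFineDual'`), the inclusion «`ker δ ⊆
range toX`» of `Function.Exact toX δ` says: a character `χ` of `Sel♭(E/ℚ_∞)` killing `Sel₀(ℚ_∞, E[p^∞])` is `s ↦ w(p^kQ)/p^k` for some functional
`w : E(ℚ_∞·ℚ_v) → ℤ_p`.  This is Pontryagin duality for the pair `(E(ℚ_∞·ℚ_v) ⊗ ℚ_p/ℤ_p, Hom(E(ℚ_∞·ℚ_v), ℤ_p))` together with the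
INJECTIVITY of `Sel♭/Sel₀ → E(ℚ_∞·ℚ_v) ⊗ ℚ_p/ℤ_p`, and the tree has every piece: the Kummer pairing `λ : Sel♭ → 𝒟` into the group `𝒟` of pairing
characters (`OddBlindNF.exists_kummerPairingHom`, `Literature.Algebra.Module.exists_addSubgroup_padicPairingFamily`), `ker λ ⊆ Sel₀` (§1:
functionals separate `p^k E(ℚ_∞·ℚ_v)` — `exists_nsmul_eq_of_forall_addMonoidHom_padicInt_dvd`, needs NO `p`-torsion in `E(ℚ_∞·ℚ_v)`, displayed as
`hnt` (at `p = 2` on the habitat: `SSFlatEC.eq_zero_of_mem_localTowerPointsOfEmb_of_two_nsmul`; odd `p`: Sprung 2012 Lemma 2.3); then every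
conjugate of the class is principal on `Gal(ℚ̄/ℚ_∞) ⊓ D_v` — `OddBlindNF.exists_eq_resGalOfEmb_mul_of_isTopGenerator`, `exists_conjH1_kummerData` —
and `Sel₀ = Sel ∩ (locally trivial above p)`: `LocalArch.mem_fineSelmerInfty_iff_rat_two` / `…_of_odd`), descent + extension of `χ` (`ℚ/ℤ`
injective, Mathlib `CharacterModule.dual_surjective_of_injective`), and biduality «every character of `𝒟` is an evaluation»
(`exists_eval_eq_of_character_padicPairingFamily`).

## What is proved
* §0 `exists_character_extension_of_ker_le` (abstract descent + extension of a character).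
* §1 ★ `mem_fineSelmerInfty_of_forall_dvd` — a ♭-Selmer class whose Kummer datum `(Q, k)` has `p^k ∣ z(p^kQ)` for all functionals `z`
  lies in `Sel₀` (over `ℚ`, every `p`, `hnt`).
* §2 ★★ `exists_toX_apply_eq_of_transpose_eq_zero` — T-δ: for ANY `J`, ANY ♭ dual datum `D` and fine dual datum `Y` (any keys), ANY additive
  `δ` transposing `Sel₀ ≤ Sel♭` and ANY `toX` with the values (V̄): `δ y = 0 ⇒ ∃ w, toX (J w) = y`.  With `Col♭` onto (`hsurj`) this is
  `LinearMap.ker δ ≤ LinearMap.range toX` — the (⊇₂) input of `…FlatExactAssembly.lean`.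

References: [Sprung2012] Def. 7.9, Lemma 7.10, Def. 7.11 (p. 1503), Def. 7.13 (p. 1504), Prop. 7.19 (p. 1505), Lemma 2.3 (p. 1487);
[Kobayashi2003] (7.17)–(7.21) (p. 12), §2 p. 4; [GreenbergLNM1716] §2 Prop. 2.1 (p. 72), §4 pp. 121–122; [NeukirchSchmidtWingberg2008] I §1
(1.1.8); [KitajimaOtsuki2018] (4.2), Prop. 3.32; [SilvermanAEC2009] Cor. III.6.4 (b).
-/

set_option autoImplicit false
-- the Theorems namespace of this sub repeats the summit name by design (D-0017 nested layout)
set_option linter.dupNamespace false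

noncomputable section

open scoped Classical NumberField

namespace Summit.BirchSwinnertonDyer.BirchSwinnertonDyer.Theorems

namespace SSFlatPT

open NumberField IsDedekindDomain Field WeierstrassCurve
  Literature.NumberTheory.EllipticCurves Literature.NumberTheory.EllipticCurves.GreenbergSelmer
  Literature.NumberTheory.EllipticCurves.Kobayashi2003 Literature.NumberTheory.EllipticCurves.Sprung2012
  Literature.NumberTheory.EllipticCurves.Sprung2017 Literature.NumberTheory.EllipticCurves.CocycleCriteria
  Literature.NumberTheory.GaloisRepresentations Literature.Algebra.Module ZpExtension

variable (W : WeierstrassCurve ℚ) [W.IsElliptic] {p : ℕ} [hp : Fact p.Prime] (κ : ZpExtension ℚ p)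
  (v : HeightOneSpectrum (𝓞 ℚ)) {ap : ℤ} {g : absoluteGaloisGroup (v.adicCompletion ℚ)}
  {c : ℕ → localPoints W (v.adicCompletion ℚ)}


/-! ## §0 Characters: descent along a homomorphism and extension (`ℚ/ℤ` is injective) -/

/-- **Descent + extension of a character.**  For `λ : S → G`, a subgroup `𝒟 ≥ λ(S)` and a character `χ` of `S` killing `ker λ`,
there is a character `Θ` of `𝒟` with `Θ(λ s) = χ(s)`: `χ` descends to `λ(S)` and extends to `𝒟` because `ℚ/ℤ` is an injective
`ℤ`-module (Mathlib `CharacterModule.dual_surjective_of_injective`). [cite: NeukirchSchmidtWingberg2008, I §1 (1.1.8)] -/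
theorem exists_character_extension_of_ker_le {S G : Type*} [AddCommGroup S] [AddCommGroup G] (lam : S →+ G)
    (Dp : AddSubgroup G) (hST : lam.range ≤ Dp) (χ : S →+ AddCircle (1 : ℚ)) (hker : ∀ s, lam s = 0 → χ s = 0) :
    ∃ Θ : Dp →+ AddCircle (1 : ℚ), ∀ s, Θ ⟨lam s, hST ⟨s, rfl⟩⟩ = χ s := by
  classical
  have hdiff : ∀ s s', lam s = lam s' → χ s = χ s' := fun s s' h ↦ by
    rw [← sub_eq_zero, ← map_sub]
    exact hker _ (by rw [map_sub, h, sub_self])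
  have hsec : ∀ d : lam.range, ∃ s, lam s = d := fun d ↦ d.2
  choose sec hsec using hsec
  obtain ⟨χbar, hχbar⟩ : ∃ χbar : lam.range →+ AddCircle (1 : ℚ), ∀ s, χbar ⟨lam s, ⟨s, rfl⟩⟩ = χ s := by
    refine ⟨{ toFun := fun d ↦ χ (sec d)
              map_zero' := hker _ (by rw [hsec, ZeroMemClass.coe_zero])
              map_add' := fun d₁ d₂ ↦ ?_ }, fun s ↦ hdiff _ _ (hsec _)⟩
    have h : lam (sec (d₁ + d₂)) = lam (sec d₁ + sec d₂) := by
      rw [map_add, hsec, hsec, hsec, AddSubgroup.coe_add]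
    change χ (sec (d₁ + d₂)) = χ (sec d₁) + χ (sec d₂)
    rw [hdiff _ _ h, map_add]
  obtain ⟨Θ, hΘ⟩ := CharacterModule.dual_surjective_of_injective (R := ℤ) (AddSubgroup.inclusion hST).toIntLinearMap
    (AddSubgroup.inclusion_injective hST) χbar
  refine ⟨Θ, fun s ↦ ?_⟩
  have h := DFunLike.congr_fun hΘ ⟨lam s, ⟨s, rfl⟩⟩
  rw [CharacterModule.dual_apply] at h
  change Θ (AddSubgroup.inclusion hST ⟨lam s, ⟨s, rfl⟩⟩) = χbar ⟨lam s, ⟨s, rfl⟩⟩ at h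
  rw [hχbar] at h
  exact h

/-! ## §1 A ♭-Selmer class whose Kummer datum is invisible to every functional lies in the fine Selmer group -/

/-- **Kernel step.**  Over `ℚ`, for any `ℤ_p`-extension `κ` with a local `g` restricting to a topological generator, the place
`v ∋ p`, and `E(ℚ_∞·ℚ_v)` without `p`-torsion (`hnt`): if a class `s ∈ Sel♭` has a Kummer datum `(φ, Q, k)` at the chosen place with
`p^k ∣ z(p^k Q)` for EVERY functional `z : E(ℚ_∞·ℚ_v) → ℤ_p`, then `s ∈ Sel₀(ℚ_∞, E[p^∞])`.  Proof: functionals separate `p^k E(ℚ_∞·ℚ_v)`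
(`exists_nsmul_eq_of_forall_addMonoidHom_padicInt_dvd`), so `p^k Q = p^k R` with `R ∈ E(ℚ_∞·ℚ_v)` and `Q − R` is a geometric torsion point
(`exists_pointsMapOfEmb_eq_of_nsmul_eq_zero`); hence every conjugate `conj_σ s` (`σ = res δ · h`, datum `(φ^δ, δ•Q, k)`,
`OddBlindNF.exists_conjH1_kummerData`) is principal on `Gal(ℚ̄/ℚ_∞) ⊓ D_v`, i.e. lies in `awayKer v`, and the fine Selmer group is the
classical one cut by exactly these conditions (`LocalArch.mem_fineSelmerInfty_iff_rat_two` / `…_of_odd`).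
[cite: Sprung2012, Def. 7.11 (p. 1503) and Def. 7.13 (p. 1504)] [cite: GreenbergLNM1716, §2 Prop. 2.1 (p. 72)]
[cite: NeukirchSchmidtWingberg2008, I §1 (1.1.8)] -/
theorem mem_fineSelmerInfty_of_forall_dvd (hv : (p : 𝓞 ℚ) ∈ v.asIdeal)
    (hg : κ.IsTopGenerator (resGalOfEmb (closureEmb (K := ℚ) (v.adicCompletion ℚ)) g))
    (hnt : ∀ P ∈ localTowerPointsOfEmb κ (closureEmb (K := ℚ) (v.adicCompletion ℚ)) W, p • P = 0 → P = 0)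
    {s : W.subgroupH1 p κ.kerSubgroup}
    (hs : s ∈ sharpFlatSelmerInfty W κ (closureEmb (K := ℚ) (v.adicCompletion ℚ)) ap g c .flat)
    (φ : contOneCocycles (discreteTopRep κ.kerSubgroup (W.geomPrimaryTorsion p)))
    (Q : localPoints W (v.adicCompletion ℚ)) (k : ℕ)
    (hQ : (p ^ k) • Q ∈ localTowerPointsOfEmb κ (closureEmb (K := ℚ) (v.adicCompletion ℚ)) W)
    (hφ : oneCocycleClass (discreteTopRep κ.kerSubgroup (W.geomPrimaryTorsion p)) φ = s)
    (hτ : ∀ τ : localSubgroupOfEmb κ.kerSubgroup (closureEmb (K := ℚ) (v.adicCompletion ℚ)),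
      pointsMapOfEmb W (closureEmb (K := ℚ) (v.adicCompletion ℚ))
          ((φ.1 (resGalSubgroupOfEmb κ.kerSubgroup _ τ) : W.geomPrimaryTorsion p) : W.geomPoints) =
        (τ : absoluteGaloisGroup (v.adicCompletion ℚ)) • Q - Q)
    (hdvd : ∀ z : localTowerPointsOfEmb κ (closureEmb (K := ℚ) (v.adicCompletion ℚ)) W →+ ℤ_[p],
      (p : ℤ_[p]) ^ k ∣ z ⟨(p ^ k) • Q, hQ⟩) :
    s ∈ W.fineSelmerInfty κ := by
  have hnt' : ∀ y : localTowerPointsOfEmb κ (closureEmb (K := ℚ) (v.adicCompletion ℚ)) W, p • y = 0 → y = 0 :=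
    fun y hy ↦ Subtype.ext (hnt y y.2 (by rw [← AddSubgroup.coe_nsmul, hy]; rfl))
  -- (1) separation: `p^k Q = p^k R`, `R ∈ E(ℚ_∞·ℚ_v)`
  obtain ⟨R, hR⟩ := exists_nsmul_eq_of_forall_addMonoidHom_padicInt_dvd hnt' hdvd
  have hR' : (p ^ k) • (R : localPoints W (v.adicCompletion ℚ)) = (p ^ k) • Q := by
    have h := congrArg Subtype.val hR
    rwa [AddSubgroup.coe_nsmul] at h
  -- (2) `Q − R` is a geometric `p^k`-torsion point `B₀`
  have hBtor : (p ^ k) • (Q - (R : localPoints W (v.adicCompletion ℚ))) = 0 := by rw [smul_sub, hR', sub_self]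
  obtain ⟨B₀, hB₀k, hB₀⟩ := exists_pointsMapOfEmb_eq_of_nsmul_eq_zero W (closureEmb (K := ℚ) (v.adicCompletion ℚ))
    (pow_ne_zero k hp.out.ne_zero) hBtor
  have hB₀mem : B₀ ∈ W.geomPrimaryTorsion p := (AddCommGroup.mem_primaryComponent).2 ⟨k, hB₀k⟩
  -- (3) every conjugate is locally trivial at `v`
  have haway : ∀ σ : absoluteGaloisGroup ℚ,
      W.conjH1 p κ.kerSubgroup σ s ∈ awayKer κ.kerSubgroup (W.geomPrimaryTorsion p) v := by
    intro σ
    obtain ⟨δ, h, hh, hσ⟩ := OddBlindNF.exists_eq_resGalOfEmb_mul_of_isTopGenerator hg σ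
    rw [OddBlindNF.conjH1_eq_conjH1_resGalOfEmb (W := W) (p := p) hh hσ]
    obtain ⟨φ', hφ', -, hτ'⟩ := OddBlindNF.exists_conjH1_kummerData (W := W) δ hQ hτ
    rw [← hφ, ← hφ', awayKer, AddMonoidHom.mem_ker, CocycleCriteria.resOfLe_oneCocycleClass_eq_zero_iff]
    -- the principal vector `res δ • B₀`
    refine ⟨resGalOfEmb (closureEmb (K := ℚ) (v.adicCompletion ℚ)) δ • (⟨B₀, hB₀mem⟩ : W.geomPrimaryTorsion p), fun x ↦ ?_⟩
    obtain ⟨τ', hτ'x⟩ := (mem_decomp_iff v (x : absoluteGaloisGroup ℚ)).1 (Subgroup.mem_inf.1 x.2).2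
    have hτ'mem : τ' ∈ localSubgroupOfEmb κ.kerSubgroup (closureEmb (K := ℚ) (v.adicCompletion ℚ)) := by
      rw [mem_localSubgroupOfEmb_iff]
      have h1 : resGalOfEmb (closureEmb (K := ℚ) (v.adicCompletion ℚ)) τ' = (x : absoluteGaloisGroup ℚ) := hτ'x
      rw [h1]
      exact (Subgroup.mem_inf.1 x.2).1
    have hx : Subgroup.inclusion (inf_le_left : κ.kerSubgroup ⊓ decomp v ≤ κ.kerSubgroup) x =
        resGalSubgroupOfEmb κ.kerSubgroup _ ⟨τ', hτ'mem⟩ := Subtype.ext hτ'x.symm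
    have e := hτ' ⟨τ', hτ'mem⟩
    -- `δ R ∈ E(ℚ_∞·ℚ_v)` is fixed by `τ'`
    have hδR : δ • (R : localPoints W (v.adicCompletion ℚ)) ∈
        localTowerPointsOfEmb κ (closureEmb (K := ℚ) (v.adicCompletion ℚ)) W := smul_mem_localTowerPointsOfEmb κ _ W δ R.2
    have hfix : τ' • (δ • (R : localPoints W (v.adicCompletion ℚ))) = δ • (R : localPoints W (v.adicCompletion ℚ)) :=
      (mem_localTowerPointsOfEmb_iff κ _ W _).1 hδR τ' hτ'mem
    have hQ' : Q = pointsMapOfEmb W (closureEmb (K := ℚ) (v.adicCompletion ℚ)) B₀ + (R : localPoints W (v.adicCompletion ℚ)) := by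
      rw [hB₀]; abel
    apply Subtype.ext
    apply pointsMapOfEmb_injective W (closureEmb (K := ℚ) (v.adicCompletion ℚ))
    have step : pointsMapOfEmb W (closureEmb (K := ℚ) (v.adicCompletion ℚ))
          ((x : absoluteGaloisGroup ℚ) • (resGalOfEmb (closureEmb (K := ℚ) (v.adicCompletion ℚ)) δ • B₀)) =
        τ' • (δ • pointsMapOfEmb W (closureEmb (K := ℚ) (v.adicCompletion ℚ)) B₀) := by
      rw [← pointsMapOfEmb_smul W _ δ B₀, ← pointsMapOfEmb_smul W _ τ', ← hτ'x]
      rfl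
    rw [hx, AddSubgroupClass.coe_sub, primaryComponent.coe_smul, map_sub, primaryComponent.coe_smul, step,
      pointsMapOfEmb_smul, e, hQ']
    show τ' • δ • (pointsMapOfEmb W _ B₀ + (R : localPoints W (v.adicCompletion ℚ))) -
        δ • (pointsMapOfEmb W _ B₀ + (R : localPoints W (v.adicCompletion ℚ))) =
      τ' • δ • pointsMapOfEmb W _ B₀ - δ • pointsMapOfEmb W _ B₀
    rw [smul_add, smul_add, hfix]
    abel
  -- (4) the fine Selmer group is cut out by these conditions
  have hsel : s ∈ W.selmerInfty κ := sharpFlatSelmerInfty_le_selmerInfty W κ _ ap g c .flat hs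
  have huniq : ∀ v' : HeightOneSpectrum (𝓞 ℚ), ((p : ℕ) : 𝓞 ℚ) ∈ v'.asIdeal → v' = v := fun v' hv' ↦
    ((natCast_mem_asIdeal_iff_eq_primesEquiv_symm v' hp.out).mp hv').trans
      ((natCast_mem_asIdeal_iff_eq_primesEquiv_symm v hp.out).mp hv).symm
  by_cases hp2 : p = 2
  · subst hp2
    refine (AlignedTransportAtTwoFineRoad.LocalArch.mem_fineSelmerInfty_iff_rat_two W κ s).2 ⟨hsel, fun v' hv' σ ↦ ?_⟩
    obtain rfl := huniq v' hv'
    exact haway σ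
  · refine (AlignedTransportAtTwoFineRoad.LocalArch.mem_fineSelmerInfty_iff_of_odd W κ hp2 s).2 ⟨hsel, fun v' hv' σ ↦ ?_⟩
    obtain rfl := huniq v' hv'
    exact haway σ

/-! ## §2 T-δ: `ker δ ⊆ range toX` — every character of `Sel♭` vanishing on `Sel₀` is the Kummer pairing with a functional -/

/-- ★★ **T-δ: `ker δ ≤ range toX`.**  Over `ℚ`, for every prime `p`, every `ℤ_p`-extension `κ` with a local `g` restricting to a topological
generator, the place `v ∋ p`, `E(ℚ_∞·ℚ_v)` without `p`-torsion (`hnt`; at `p = 2` on the habitat `SSFlatEC.eq_zero_of_mem_localTowerPointsOfEmb_of_two_nsmul`,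
odd `p` Sprung's Lemma 2.3), ANY ♭ dual datum `D` (any key), ANY fine dual datum `Y` (any key), an additive `δ : D.X → Y.X` TRANSPOSING
`Sel₀ ≤ Sel♭` (`hδ`, the (δ̄)-hypothesis shape of `SSFlatPackage.exists_flatToXLinearMap_of_mul_eq_one`) and any `toX ∘ J` with the Kummer values
(V̄): **every `y ∈ D.X` with `δ y = 0` is `toX (J w)` for some functional `w`** — so `ker δ ⊆ range toX` once `Col♭ = (J ·)` is onto.
Proof (Pontryagin, no topology): `χ = D.toDual y` kills `Sel₀`; the Kummer pairing `λ : Sel♭ → 𝒟 ⊆ Hom(Hom(E(ℚ_∞·ℚ_v), ℤ_p), ℚ/ℤ)`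
(`OddBlindNF.exists_kummerPairingHom` into the group `𝒟` of pairing characters, `exists_addSubgroup_padicPairingFamily`) has `ker λ ≤ Sel₀`
(§1), so `χ` descends to `λ(Sel♭)`, extends to `𝒟` (`ℚ/ℤ` injective: `CharacterModule.dual_surjective_of_injective`), and every character of
`𝒟` is the evaluation at a functional `w` (`exists_eval_eq_of_character_padicPairingFamily`); then `χ(s) = w(p^kQ)/p^k` = (V̄).
[cite: Sprung2012, Def. 7.9, Def. 7.11 (p. 1503), Prop. 7.19 (p. 1505)] [cite: Kobayashi2003, (7.17)–(7.21) (p. 12)]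
[cite: NeukirchSchmidtWingberg2008, I §1 (1.1.8)] [cite: GreenbergLNM1716, §4 pp. 121–122] -/
theorem exists_toX_apply_eq_of_transpose_eq_zero (hv : (p : 𝓞 ℚ) ∈ v.asIdeal)
    (hg : κ.IsTopGenerator (resGalOfEmb (closureEmb (K := ℚ) (v.adicCompletion ℚ)) g))
    (hnt : ∀ P ∈ localTowerPointsOfEmb κ (closureEmb (K := ℚ) (v.adicCompletion ℚ)) W, p • P = 0 → P = 0)
    {Λ' : Type*} (J : (localTowerPointsOfEmb κ (closureEmb (K := ℚ) (v.adicCompletion ℚ)) W →+ ℤ_[p]) → Λ')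
    {δk : absoluteGaloisGroup ℚ}
    (D : SharpFlatSelmerDualData W κ δk (closureEmb (K := ℚ) (v.adicCompletion ℚ)) ap g c .flat) (toX : Λ' → D.X)
    (hV : ∀ (w : localTowerPointsOfEmb κ (closureEmb (K := ℚ) (v.adicCompletion ℚ)) W →+ ℤ_[p])
        (s : sharpFlatSelmerInfty W κ (closureEmb (K := ℚ) (v.adicCompletion ℚ)) ap g c .flat)
        (φ : contOneCocycles (discreteTopRep κ.kerSubgroup (W.geomPrimaryTorsion p)))
        (Q : localPoints W (v.adicCompletion ℚ)) (k : ℕ)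
        (hQ : (p ^ k) • Q ∈ localTowerPointsOfEmb κ (closureEmb (K := ℚ) (v.adicCompletion ℚ)) W),
        oneCocycleClass (discreteTopRep κ.kerSubgroup (W.geomPrimaryTorsion p)) φ = (s : W.subgroupH1 p κ.kerSubgroup) →
        (∀ τ : localSubgroupOfEmb κ.kerSubgroup (closureEmb (K := ℚ) (v.adicCompletion ℚ)),
          pointsMapOfEmb W (closureEmb (K := ℚ) (v.adicCompletion ℚ))
              ((φ.1 (resGalSubgroupOfEmb κ.kerSubgroup _ τ) : W.geomPrimaryTorsion p) : W.geomPoints) =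
            (τ : absoluteGaloisGroup (v.adicCompletion ℚ)) • Q - Q) →
        ∀ a : ℤ, PadicInt.toZModPow k (w ⟨(p ^ k) • Q, hQ⟩) = (a : ZMod (p ^ k)) →
          D.toDual (toX (J w)) s = (((a : ℚ) / (p : ℚ) ^ k : ℚ) : AddCircle (1 : ℚ)))
    {γ' : absoluteGaloisGroup ℚ} (Y : W.FineSelmerDualData κ γ') (δ : D.X →+ Y.X)
    (hδ : ∀ (x : D.X) (s : W.fineSelmerInfty κ),
      Y.toDual (δ x) s = D.toDual x (AddSubgroup.inclusion (fineSelmerInfty_le_sharpFlatSelmerInfty W κ v ap g c .flat) s))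
    (y : D.X) (hy : δ y = 0) :
    ∃ w : localTowerPointsOfEmb κ (closureEmb (K := ℚ) (v.adicCompletion ℚ)) W →+ ℤ_[p], toX (J w) = y := by
  classical
  -- (0) `χ = D.toDual y` kills `Sel₀`
  have hχ0 : ∀ s : sharpFlatSelmerInfty W κ (closureEmb (K := ℚ) (v.adicCompletion ℚ)) ap g c .flat,
      (s : W.subgroupH1 p κ.kerSubgroup) ∈ W.fineSelmerInfty κ → D.toDual y s = 0 := by
    intro s hs
    have h := hδ y ⟨s, hs⟩
    rw [hy, map_zero, AddMonoidHom.zero_apply] at h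
    have e : AddSubgroup.inclusion (fineSelmerInfty_le_sharpFlatSelmerInfty W κ v ap g c .flat)
        ⟨(s : W.subgroupH1 p κ.kerSubgroup), hs⟩ = s := Subtype.ext rfl
    rw [e] at h
    exact h.symm
  -- (1) the pairing characters, their group `𝒟`, the Kummer pairing `Φ`
  obtain ⟨e, he⟩ := exists_padicPairingFamily (N := localTowerPointsOfEmb κ (closureEmb (K := ℚ) (v.adicCompletion ℚ)) W) (p := p)
  obtain ⟨Dp, hDp⟩ := exists_addSubgroup_padicPairingFamily he
  obtain ⟨Φ, hΦ⟩ := OddBlindNF.exists_kummerPairingHom (κ := κ) (ι := closureEmb (K := ℚ) (v.adicCompletion ℚ)) (W := W) he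
  -- (2) `Sel♭ ≤ localKummer`, and a Kummer datum for each `s ∈ Sel♭`
  have hmem1 : ∀ s : sharpFlatSelmerInfty W κ (closureEmb (K := ℚ) (v.adicCompletion ℚ)) ap g c .flat,
      (s : W.subgroupH1 p κ.kerSubgroup) ∈ sharpFlatLocalKummerOverOfEmb W p κ.kerSubgroup (closureEmb (K := ℚ) (v.adicCompletion ℚ))
        (localTowerPointsOfEmb κ (closureEmb (K := ℚ) (v.adicCompletion ℚ)) W)
        (colemanKer κ (closureEmb (K := ℚ) (v.adicCompletion ℚ)) W ap g c .flat) := fun s ↦ by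
    have h := ((mem_sharpFlatSelmerInfty_iff W κ _ ap g c .flat (s : W.subgroupH1 p κ.kerSubgroup)).1 s.2).2 1
    rwa [W.conjH1_one_holds p κ.kerSubgroup, AddMonoidHom.id_apply] at h
  have hle : sharpFlatSelmerInfty W κ (closureEmb (K := ℚ) (v.adicCompletion ℚ)) ap g c .flat ≤
      localKummerOverOfEmb W p κ.kerSubgroup (closureEmb (K := ℚ) (v.adicCompletion ℚ))
        (localTowerPointsOfEmb κ (closureEmb (K := ℚ) (v.adicCompletion ℚ)) W) :=
    fun s hs ↦ sharpFlatLocalKummerOverOfEmb_le_localKummerOverOfEmb _ _ (hmem1 ⟨s, hs⟩)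
  have hdata : ∀ s : sharpFlatSelmerInfty W κ (closureEmb (K := ℚ) (v.adicCompletion ℚ)) ap g c .flat,
      ∃ (φ : contOneCocycles (discreteTopRep κ.kerSubgroup (W.geomPrimaryTorsion p)))
        (Q : localPoints W (v.adicCompletion ℚ)) (k : ℕ)
        (hQ : (p ^ k) • Q ∈ localTowerPointsOfEmb κ (closureEmb (K := ℚ) (v.adicCompletion ℚ)) W),
        oneCocycleClass (discreteTopRep κ.kerSubgroup (W.geomPrimaryTorsion p)) φ = (s : W.subgroupH1 p κ.kerSubgroup) ∧
        ∀ τ : localSubgroupOfEmb κ.kerSubgroup (closureEmb (K := ℚ) (v.adicCompletion ℚ)),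
          pointsMapOfEmb W (closureEmb (K := ℚ) (v.adicCompletion ℚ))
              ((φ.1 (resGalSubgroupOfEmb κ.kerSubgroup _ τ) : W.geomPrimaryTorsion p) : W.geomPoints) =
            (τ : absoluteGaloisGroup (v.adicCompletion ℚ)) • Q - Q := fun s ↦ by
    obtain ⟨φ, Q, k, hQ, hφ, -, hτ⟩ := (mem_sharpFlatLocalKummerOverOfEmb_iff _ _ _).1 (hmem1 s)
    exact ⟨φ, Q, k, hQ, hφ, hτ⟩
  choose φ Q k hQ hφ hτ using hdata
  -- (3) `λ : Sel♭ → Hom(Hom(E(ℚ_∞·ℚ_v), ℤ_p), ℚ/ℤ)`, with values in `𝒟`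
  have hΦeq : ∀ s : sharpFlatSelmerInfty W κ (closureEmb (K := ℚ) (v.adicCompletion ℚ)) ap g c .flat,
      Φ ⟨s, hle s.2⟩ = e ⟨_, hQ s⟩ (k s) := fun s ↦ hΦ ⟨s, hle s.2⟩ (φ s) (Q s) (k s) (hQ s) (hφ s) (hτ s)
  set lam : sharpFlatSelmerInfty W κ (closureEmb (K := ℚ) (v.adicCompletion ℚ)) ap g c .flat →+
      ((localTowerPointsOfEmb κ (closureEmb (K := ℚ) (v.adicCompletion ℚ)) W →+ ℤ_[p]) →+ AddCircle (1 : ℚ)) :=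
    Φ.comp (AddSubgroup.inclusion hle) with hlam_def
  have hlam : ∀ s, lam s = e ⟨_, hQ s⟩ (k s) := fun s ↦ hΦeq s
  have hST : lam.range ≤ Dp := by
    rintro _ ⟨s, rfl⟩
    exact (hDp _).2 ⟨⟨_, hQ s⟩, k s, hlam s⟩
  -- (4) `ker λ` kills `χ`
  have hker : ∀ s, lam s = 0 → D.toDual y s = 0 := by
    intro s hs0
    refine hχ0 s (mem_fineSelmerInfty_of_forall_dvd W κ v hv hg hnt s.2 (φ s) (Q s) (k s) (hQ s) (hφ s) (hτ s) fun z ↦ ?_)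
    have h1 : e ⟨_, hQ s⟩ (k s) z = 0 := by rw [← hlam s, hs0, AddMonoidHom.zero_apply]
    exact (padicPairingFamily_apply_eq_zero_iff he _ _ z).1 h1
  -- (5)–(6) descend `χ` to `λ(Sel♭)` and extend to `𝒟`
  obtain ⟨Θ, hΘ⟩ := exists_character_extension_of_ker_le lam Dp hST (D.toDual y) hker
  -- (7) biduality: `Θ` is the evaluation at a functional `w`
  obtain ⟨w, hw⟩ := exists_eval_eq_of_character_padicPairingFamily he hDp Θ
  refine ⟨w, D.bijective.1 (AddMonoidHom.ext fun s ↦ ?_)⟩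
  obtain ⟨a, ha⟩ := ZMod.intCast_surjective (PadicInt.toZModPow (k s) (w ⟨_, hQ s⟩))
  have h1 : Θ ⟨lam s, hST ⟨s, rfl⟩⟩ = (((a : ℚ) / (p : ℚ) ^ (k s) : ℚ) : AddCircle (1 : ℚ)) := by
    rw [hw]
    change lam s w = _
    rw [hlam s, he _ _ w a ha.symm]
  rw [hV w s (φ s) (Q s) (k s) (hQ s) (hφ s) (hτ s) a ha.symm, ← hΘ s]
  exact h1.symm

end SSFlatPT

end Summit.BirchSwinnertonDyer.BirchSwinnertonDyer.Theorems

end
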